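import Mathlib.Data.Finset.Card
import Mathlib.Algebra.Order.BigOperators.Group.List
import Mathlib.Algebra.Order.Group.Nat
import Mathlib.Logic.Relation
import HarnessLib

/-!
# Premise DAGs of line-based derivations: ancestor sets and tree-likeness

The tree's line-based proof systems (`Resolution.lean`, `ResLin.lean`, `CuttingPlanes*.lean`, …)
record a derivation as a list of lines, each line carrying the list of indices of its premises.
The purely combinatorial part of the size arguments for TREE-LIKE derivations (Ben-Sasson–Wigderson
2001 Thm 3.3; the Prover–Delayer games of Pudlák–Impagliazzo 2000 and Itsykson–Sokolov 2014/2020)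
only uses this PREMISE DAG `prem : List (List ℕ)` (`prem[b]` = the premises of node `b`):

* `DagConsumes prem a b` — node `b` uses node `a` as a premise; `IsPremiseDag prem` — premises
  come earlier (true for every valid derivation); `IsTreeLikeDag prem` — every node is used as a
  premise at most once, counted with multiplicity (the tree's `IsTreeLike`, stated on the DAG);
* `dagAncestors prem k` — the nodes from which `k` is reachable along premise edges (the
  sub-derivation ending in `k`), with `|dagAncestors prem k| ≤ k + 1`;
* for a tree-like DAG the premise relation is right-unique (`dagConsumes_rightUnique`), the
  sub-derivations of two distinct premises of one node are disjoint (`disjoint_dagAncestors`) and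
  their sizes add up below the size of the conclusion's (`card_dagAncestors_add_lt` — the list form
  of "`S = S₁ + S₂ + 1`" for a binary inference).

This is the generic form of the ancestor machinery of `ResolutionTreeLikeSizeWidth.lean` (there for
`ResLine`), written once for all line-based systems; a system instantiates it with
`prem := π.map (·.premises)`. Nothing here depends on clauses or rules.

## References

* E. Ben-Sasson, A. Wigderson, *Short proofs are narrow — resolution made simple*, J. ACM 48 (2001),
  §2 (tree-like refutations: the proof DAG is a tree), Thm 3.3 (`S = S₁ + S₂ + 1`).
* S. Jukna, *Boolean Function Complexity*, Springer 2012, §18.1, p. 500 (tree-like resolution: the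
  definition); Lemma 18.4 (the Prover–Delayer bound) uses the same disjoint-subtree count.
-/

namespace Literature.Computability.MetaComplexity

/-! ### Premise DAGs -/

/-- `DagConsumes prem a b`: node `b` of the premise DAG `prem` (node `b` has premise list `prem[b]`)
uses node `a` as a premise. [Ben-Sasson–Wigderson 2001, §2 (the proof DAG)] [folklore] -/
def DagConsumes (prem : List (List ℕ)) (a b : ℕ) : Prop :=
  ∃ hb : b < prem.length, a ∈ prem[b]'hb

/-- A premise DAG is well-formed when premises come earlier: every premise index of node `b` is
`< b` (this holds for every valid line-based derivation, whose premise indices point into the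
prefix). [Ben-Sasson–Wigderson 2001, §2] [folklore] -/
def IsPremiseDag (prem : List (List ℕ)) : Prop :=
  ∀ (b : ℕ) (hb : b < prem.length), ∀ a ∈ prem[b]'hb, a < b

/-- TREE-LIKENESS of a premise DAG: every node is used as a premise at most once, counted with
multiplicity — the proof DAG is a forest (the tree's `IsTreeLike`, read on the premise lists).
[Ben-Sasson–Wigderson 2001, §2 (tree-like); Jukna 2012, §18.1] [folklore] -/
def IsTreeLikeDag (prem : List (List ℕ)) : Prop :=
  ∀ i : ℕ, (prem.map fun l => l.count i).sum ≤ 1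

variable {prem : List (List ℕ)}

/-- In a well-formed premise DAG, premises come earlier. [folklore] -/
theorem DagConsumes.lt (hprem : IsPremiseDag prem) {a b : ℕ} (h : DagConsumes prem a b) : a < b := by
  obtain ⟨hb, ha⟩ := h
  exact hprem b hb a ha

/-- A node reachable from `a` along premise edges comes no earlier than `a`. [folklore] -/
theorem le_of_reflTransGen_dagConsumes (hprem : IsPremiseDag prem) {a b : ℕ}
    (h : Relation.ReflTransGen (DagConsumes prem) a b) : a ≤ b := by
  induction h with
  | refl => exact le_rfl
  | tail _ hbc ih => exact ih.trans (hbc.lt hprem).le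

/-- Tree-likeness makes the premise relation right-unique: every node has at most one consumer.
[Ben-Sasson–Wigderson 2001, §2] [folklore] -/
theorem dagConsumes_rightUnique (htree : IsTreeLikeDag prem) :
    Relator.RightUnique (DagConsumes prem) := by
  intro c p p' hp hp'
  obtain ⟨hp, hc⟩ := hp
  obtain ⟨hp', hc'⟩ := hp'
  by_contra hne
  have key : ∀ {a b : ℕ} (ha : a < prem.length) (hb : b < prem.length), a < b →
      c ∈ prem[a]'ha → c ∈ prem[b]'hb → False := by
    intro a b ha hb hab hca hcb
    have hsum := htree c
    have hsplit : (prem.map fun l => l.count c).sum =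
        ((prem.take b).map fun l => l.count c).sum +
          ((prem.drop b).map fun l => l.count c).sum := by
      rw [← List.sum_append, ← List.map_append, List.take_append_drop]
    have h1 : 1 ≤ ((prem.take b).map fun l => l.count c).sum := by
      have hmem : (prem[a]'ha).count c ∈ (prem.take b).map fun l => l.count c :=
        List.mem_map.2 ⟨prem[a]'ha, List.mem_take_iff_getElem.2 ⟨a, by simp [hab, ha], by simp⟩, rfl⟩
      exact le_trans (List.count_pos_iff.2 hca) (List.le_sum_of_mem hmem)
    have h2 : 1 ≤ ((prem.drop b).map fun l => l.count c).sum := by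
      have hmem : (prem[b]'hb).count c ∈ (prem.drop b).map fun l => l.count c := by
        refine List.mem_map.2 ⟨prem[b]'hb, ?_, rfl⟩
        rw [List.mem_iff_getElem]
        exact ⟨0, by simp; omega, by simp⟩
      exact le_trans (List.count_pos_iff.2 hcb) (List.le_sum_of_mem hmem)
    omega
  rcases lt_or_gt_of_ne hne with h | h
  · exact key hp hp' h hc hc'
  · exact key hp' hp h hc' hc

/-- In a tree-like DAG no premise is used twice by the same node: a node with premise list
`[i, j]` has `i ≠ j`. [Ben-Sasson–Wigderson 2001, §2] [folklore] -/
theorem ne_of_isTreeLikeDag_pair (htree : IsTreeLikeDag prem) {b i j : ℕ} (hb : b < prem.length)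
    (hpair : prem[b]'hb = [i, j]) : i ≠ j := by
  intro hij
  subst hij
  have hsum := htree i
  have hmem : (prem[b]'hb).count i ∈ prem.map fun l => l.count i :=
    List.mem_map.2 ⟨prem[b]'hb, List.getElem_mem hb, rfl⟩
  have h2 : (prem[b]'hb).count i = 2 := by simp [hpair]
  have := List.le_sum_of_mem hmem
  omega

/-! ### Ancestor sets -/

/-- The ANCESTOR SET of node `k`: the nodes `a ≤ k` from which `k` is reachable along premise
edges (including `k`) — the sub-derivation ending in node `k`. [Ben-Sasson–Wigderson 2001, Thm 3.3
(the sub-derivations of the two premises of the last step)] [folklore] -/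
noncomputable def dagAncestors (prem : List (List ℕ)) (k : ℕ) : Finset ℕ := by
  classical exact (Finset.range (k + 1)).filter fun a => Relation.ReflTransGen (DagConsumes prem) a k

/-- Membership in the ancestor set (well-formed DAGs). [folklore] -/
theorem mem_dagAncestors_iff (hprem : IsPremiseDag prem) {a k : ℕ} :
    a ∈ dagAncestors prem k ↔ Relation.ReflTransGen (DagConsumes prem) a k := by
  classical
  unfold dagAncestors
  rw [Finset.mem_filter, Finset.mem_range, and_iff_right_iff_imp]
  intro h
  exact Nat.lt_succ_of_le (le_of_reflTransGen_dagConsumes hprem h)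

/-- A node is its own ancestor. [folklore] -/
theorem self_mem_dagAncestors (k : ℕ) : k ∈ dagAncestors prem k := by
  classical
  exact Finset.mem_filter.2 ⟨Finset.mem_range.2 (Nat.lt_succ_self k), Relation.ReflTransGen.refl⟩

/-- Ancestor sets are nonempty. [folklore] -/
theorem card_dagAncestors_pos (k : ℕ) : 0 < (dagAncestors prem k).card :=
  Finset.card_pos.2 ⟨k, self_mem_dagAncestors k⟩

/-- The ancestor set of node `k` has at most `k + 1` elements. [folklore] -/
theorem card_dagAncestors_le (k : ℕ) : (dagAncestors prem k).card ≤ k + 1 := by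
  classical
  unfold dagAncestors
  exact (Finset.card_filter_le _ _).trans (by simp)

/-- Ancestors of a premise are ancestors of the conclusion. [folklore] -/
theorem dagAncestors_subset_of_dagConsumes (hprem : IsPremiseDag prem) {a k : ℕ}
    (h : DagConsumes prem a k) : dagAncestors prem a ⊆ dagAncestors prem k := by
  intro x hx
  rw [mem_dagAncestors_iff hprem] at hx ⊢
  exact hx.tail h

/-- The sub-derivation of a premise is at most as large as the conclusion's. [folklore] -/
theorem card_dagAncestors_le_of_dagConsumes (hprem : IsPremiseDag prem) {a k : ℕ}
    (h : DagConsumes prem a k) : (dagAncestors prem a).card ≤ (dagAncestors prem k).card :=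
  Finset.card_le_card (dagAncestors_subset_of_dagConsumes hprem h)

/-- A node is not an ancestor of its premises. [folklore] -/
theorem notMem_dagAncestors_of_dagConsumes (hprem : IsPremiseDag prem) {a k : ℕ}
    (h : DagConsumes prem a k) : k ∉ dagAncestors prem a := by
  intro hk
  rw [mem_dagAncestors_iff hprem] at hk
  have h1 := le_of_reflTransGen_dagConsumes hprem hk
  have h2 := h.lt hprem
  omega

/-- In a tree-like DAG the sub-derivations of two distinct premises of one node are disjoint.
[Ben-Sasson–Wigderson 2001, §2 and Thm 3.3] [folklore] -/
theorem disjoint_dagAncestors (hprem : IsPremiseDag prem) (htree : IsTreeLikeDag prem)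
    {i j k : ℕ} (hi : DagConsumes prem i k) (hj : DagConsumes prem j k) (hij : i ≠ j) :
    Disjoint (dagAncestors prem i) (dagAncestors prem j) := by
  rw [Finset.disjoint_left]
  intro x hxi hxj
  rw [mem_dagAncestors_iff hprem] at hxi hxj
  have hU := dagConsumes_rightUnique htree
  have key : ∀ {i j : ℕ}, DagConsumes prem i k → DagConsumes prem j k → i ≠ j →
      ¬ Relation.ReflTransGen (DagConsumes prem) i j := by
    intro i j hi hj hij hij'
    rcases hij'.cases_head with h | ⟨c, hic, hcj⟩
    · exact hij h
    · have hck : c = k := hU hic hi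
      subst hck
      have h1 := le_of_reflTransGen_dagConsumes hprem hcj
      have h2 := hj.lt hprem
      omega
  rcases Relation.ReflTransGen.total_of_right_unique hU hxi hxj with h | h
  · exact key hi hj hij h
  · exact key hj hi hij.symm h

/-- Sizes of sub-derivations add up [Ben-Sasson–Wigderson 2001, Thm 3.3 (`S = S₁ + S₂ + 1`)]:
`|ancestors i| + |ancestors j| < |ancestors k|` for a node `k` with two distinct premises `i, j`
of a tree-like DAG. [folklore] -/
theorem card_dagAncestors_add_lt (hprem : IsPremiseDag prem) (htree : IsTreeLikeDag prem)
    {i j k : ℕ} (hi : DagConsumes prem i k) (hj : DagConsumes prem j k) (hij : i ≠ j) :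
    (dagAncestors prem i).card + (dagAncestors prem j).card < (dagAncestors prem k).card := by
  classical
  have hdisj := disjoint_dagAncestors hprem htree hi hj hij
  have hsub : dagAncestors prem i ∪ dagAncestors prem j ⊆ (dagAncestors prem k).erase k := by
    intro x hx
    rw [Finset.mem_erase]
    rcases Finset.mem_union.1 hx with h | h
    · exact ⟨fun hxk => notMem_dagAncestors_of_dagConsumes hprem hi (hxk ▸ h),
        dagAncestors_subset_of_dagConsumes hprem hi h⟩
    · exact ⟨fun hxk => notMem_dagAncestors_of_dagConsumes hprem hj (hxk ▸ h),
        dagAncestors_subset_of_dagConsumes hprem hj h⟩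
  have h1 := Finset.card_le_card hsub
  rw [Finset.card_union_of_disjoint hdisj,
    Finset.card_erase_of_mem (self_mem_dagAncestors k)] at h1
  have h2 : 0 < (dagAncestors prem k).card := card_dagAncestors_pos k
  omega

/-- The sub-derivation of a (single) premise is smaller. [folklore] -/
theorem card_dagAncestors_lt_of_dagConsumes (hprem : IsPremiseDag prem) {a k : ℕ}
    (h : DagConsumes prem a k) : (dagAncestors prem a).card < (dagAncestors prem k).card := by
  classical
  refine Finset.card_lt_card ⟨dagAncestors_subset_of_dagConsumes hprem h, fun hsub => ?_⟩
  exact notMem_dagAncestors_of_dagConsumes hprem h (hsub (self_mem_dagAncestors k))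

/-- "Take the smaller subtree": for two distinct premises `i, j` of a node `k` of a tree-like DAG,
the smaller sub-derivation has less than half the lines of `k`'s, in the form used with `Nat.log`:
`2 · min |ancestors i| |ancestors j| < |ancestors k|`. [Jukna 2012, Lemma 18.4 (proof)] [folklore] -/
theorem two_mul_min_card_dagAncestors_lt (hprem : IsPremiseDag prem) (htree : IsTreeLikeDag prem)
    {i j k : ℕ} (hi : DagConsumes prem i k) (hj : DagConsumes prem j k) (hij : i ≠ j) :
    2 * min (dagAncestors prem i).card (dagAncestors prem j).card < (dagAncestors prem k).card := by
  have h := card_dagAncestors_add_lt hprem htree hi hj hij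
  have h1 := min_le_left (dagAncestors prem i).card (dagAncestors prem j).card
  have h2 := min_le_right (dagAncestors prem i).card (dagAncestors prem j).card
  omega

end Literature.Computability.MetaComplexity
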